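import Mathlib
import Summits.Schanuel.Schanuel.Theorems.AclSubsetLogFreeCore.Negative.LogFreeCoreObjects
import Literature.NumberTheory.Transcendental.LindemannWeierstrassProofs
import Literature.Barriers.Schanuel.AlgebraicIndependenceOfLogarithms
import Literature.Barriers.Schanuel.LargeTranscendenceDegreeSmallTrdegProofs
import Literature.Barriers.Schanuel.NesterenkoModularScopeConjectureProofs

/-!
# Line `kernel-tower-relative-lw` of crux `RigidCore.SchanuelOnLogFreeCore`: `RelLW₀` off the axes (`π ⊥ e^α`)

Crux `stmt-Schanuel-0970` (`Summit.Schanuel.Schanuel.Theses.RigidCore.SchanuelOnLogFreeCore`,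
Schanuel's conjecture on the log-free core `C_EA`), line `kernel-tower-relative-lw`.  The line's
level-`0` layer `RelLW₀` says: exponentials of elements of `L₀ = stage 0 = ℚ(2πi)^{ralg}`
(`Summit.Schanuel.Schanuel.Theorems.AclSubsetLogFreeCore.Negative.stage`) that are independent
modulo `ℚ·2πi` are algebraically independent OVER `L₀`.  In general `RelLW₀` is open (at `u = (1)`
it is `e ⊥ π`).  This file proves its instance class at `r = 1`, `u = (α)` with `α` ALGEBRAIC and
off both axes (`Re α ≠ 0`, `Im α ≠ 0`): `e^α` is transcendental over `ℚ(π)^{ralg} ⊇ L₀`, i.e. `π`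
and `e^α` are algebraically independent (e.g. `π ⊥ e^{1+i}`).

Proof (Lindemann–Weierstrass + complex conjugation).  Conjugation fixes `ℚ(π)` pointwise and maps
`e^α` to `e^{ᾱ}`; so if `e^α` were algebraic over `ℚ(π)` then so would be `e^{ᾱ}`, whence
`trdeg_ℚ ℚ(π, e^α, e^{ᾱ}) = trdeg_ℚ ℚ(π) ≤ 1`.  But `(α, ᾱ)` is `ℚ`-linearly independent — this
is exactly `Re α ≠ 0 ∧ Im α ≠ 0` — and consists of algebraic numbers, so by Lindemann–Weierstrass
(tree theorem `Literature.NumberTheory.Transcendental.algebraicIndependent_exp_holds`, PROVED;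
A. Baker, *Transcendental Number Theory* (1975), Ch. 1 Thm 1.4) `e^α, e^{ᾱ}` are algebraically
independent and the same field has `trdeg ≥ 2`: contradiction.  Finally
`L₀ = ℚ(2πi)^{ralg} ≤ ℚ(π)^{ralg}` (`two_pi_I_mem_Kpi`) and a relative algebraic closure creates
no new algebraic elements (`relAlg_closed`), so `e^α` is transcendental over `L₀`, which for a
one-element family is the registered stub.

## Main statements (namespace `Summit.Schanuel.Schanuel.Theorems.RigidCore`)

* `KernelTower.exp_transcendental_adjoin_pi_offAxes` — `e^α` is transcendental over `ℚ(π)`;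
* `KernelTower.algebraicIndependent_pi_exp_offAxes` — **`π ⊥ e^α`**
  (`AlgebraicIndependent ℚ ![π, e^α]`);
* `KernelTower.exp_not_mem_stage_zero_offAxes` — `e^α ∉ L₀ = stage 0`, and
  `KernelTower.exp_transcendental_stage_zero_offAxes` — `e^α` is transcendental over `L₀`;
* `stub_relLWZero_offAxes` — the registered stub of the line, signature verbatim:
  `AlgebraicIndependent (stage 0) (fun _ : Fin 1 => e^α)`;
* `KernelTower.algebraicIndependent_stage_zero_exp_of_conjFree` — the tuple version (below).

Helpers (sub-namespace `RelLWZeroOffAxes`, local to this file, which imports only accepted base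
modules; the sibling stub file `…RelLWZeroRatPi` of the line proves the sharper
`KernelTower.stage_zero_eq_Kpi : stage 0 = Kpi`): `natCast_le_trdeg_of_algebraicIndependent_mem`,
`conj_eq_self_of_mem_adjoin_pi`, `isAlgebraic_adjoin_pi_conj`, `linearIndependent_self_conj`,
`algebraicIndependent_exp_exp_conj`, `isAlgebraic_adjoin_pi_of_mem_stage_zero`.  The tower law
`trdeg_K K(S ∪ T) = trdeg_K K(S)` for `T` algebraic over `K(S)` is the tree's
`Literature.Barriers.Schanuel.trdeg_adjoin_union_eq_of_isAlgebraic_adjoin`.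

Tuple version (same sector, every rank): `KernelTower.algebraicIndependent_stage_zero_exp_of_conjFree`
— for algebraic `u : Fin r → ℂ` such that the `2r` numbers `(u, ū)` are `ℚ`-linearly independent,
`AlgebraicIndependent (stage 0) (e^{u i})ᵢ`.  Here Lindemann–Weierstrass makes the `2r` numbers
`(e^u, e^{ū})` algebraically independent; if `π` were algebraic over `ℚ(e^u)` then (conjugating)
also over `ℚ(e^{ū})`, so `π` would lie in the intersection of the two flats
`acl ℚ(e^u) ∩ acl ℚ(e^{ū}) = acl ℚ(∅)` of the algebraic matroid of `ℂ/ℚ`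
(`AlgebraicIndependent.matroid`, `Matroid.Indep.closure_inter_eq_inter_closure`), i.e. `π` would
be algebraic.  NOT here: nothing about `u` meeting the axes (`u = (1)` is `e ⊥ π`, open).

## References

* [BakerTNT1975] A. Baker, *Transcendental Number Theory*, Cambridge University Press (1975),
  Ch. 1 §3, Theorem 1.4 and the remark following it (Lindemann–Weierstrass), p. 6.
-/

noncomputable section

namespace Summit.Schanuel.Schanuel.Theorems.RigidCore

open IntermediateField
open Literature.NumberTheory.Transcendental
open Literature.Barriers.Schanuel
open Summit.Schanuel.Schanuel.Theorems.AclSubsetLogFreeCore.Negative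

namespace RelLWZeroOffAxes

/-! ## Helpers -/

/-- An algebraically independent family lying in an intermediate field `L` of `ℂ/ℚ` bounds
`trdeg_ℚ L` from below. [folklore] -/
theorem natCast_le_trdeg_of_algebraicIndependent_mem {n : ℕ} {L : IntermediateField ℚ ℂ}
    (y : Fin n → ℂ) (hy : AlgebraicIndependent ℚ y) (hmem : ∀ i, y i ∈ L) :
    (n : Cardinal) ≤ Algebra.trdeg ℚ L := by
  let y' : Fin n → L := fun i => ⟨y i, hmem i⟩
  have hy' : AlgebraicIndependent ℚ y' := AlgebraicIndependent.of_comp L.val (by exact hy)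
  simpa using hy'.cardinalMk_le_trdeg

/-! ## Complex conjugation and `ℚ(π)` -/

/-- Complex conjugation fixes `ℚ(π)` pointwise (`π` is real). [folklore] -/
theorem conj_eq_self_of_mem_adjoin_pi {x : ℂ}
    (hx : x ∈ adjoin ℚ ({(Real.pi : ℂ)} : Set ℂ)) : (starRingEnd ℂ) x = x := by
  induction hx using IntermediateField.adjoin_induction with
  | mem x hx =>
    rw [Set.mem_singleton_iff] at hx
    rw [hx, Complex.conj_ofReal]
  | algebraMap q => simp
  | add x y _ _ hx hy => rw [map_add, hx, hy]
  | inv x _ hx => rw [map_inv₀, hx]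
  | mul x y _ _ hx hy => rw [map_mul, hx, hy]

/-- Algebraicity over `ℚ(π)` is preserved under complex conjugation (conjugation is a
`ℚ(π)`-algebra endomorphism of `ℂ`). [folklore] -/
theorem isAlgebraic_adjoin_pi_conj {y : ℂ}
    (hy : IsAlgebraic (adjoin ℚ ({(Real.pi : ℂ)} : Set ℂ)) y) :
    IsAlgebraic (adjoin ℚ ({(Real.pi : ℂ)} : Set ℂ)) ((starRingEnd ℂ) y) := by
  let σ : ℂ →ₐ[adjoin ℚ ({(Real.pi : ℂ)} : Set ℂ)] ℂ :=
    { (starRingEnd ℂ : ℂ →+* ℂ) with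
      commutes' := fun x => conj_eq_self_of_mem_adjoin_pi x.2 }
  exact hy.algHom σ

/-! ## The pair `(α, ᾱ)` and Lindemann–Weierstrass -/

/-- For `α` off both axes the pair `(α, ᾱ)` is `ℚ`-linearly independent: a relation
`s α + t ᾱ = 0` has real part `(s + t) Re α = 0` and imaginary part `(s − t) Im α = 0`. [folklore] -/
theorem linearIndependent_self_conj {α : ℂ} (hre : α.re ≠ 0) (him : α.im ≠ 0) :
    LinearIndependent ℚ ![α, (starRingEnd ℂ) α] := by
  rw [LinearIndependent.pair_iff]
  intro s t hst
  have h1 := congrArg Complex.re hst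
  have h2 := congrArg Complex.im hst
  simp only [Complex.add_re, Complex.add_im, Complex.smul_re, Complex.smul_im, Complex.conj_re,
    Complex.conj_im, Complex.zero_re, Complex.zero_im, smul_neg] at h1 h2
  rw [Rat.smul_def, Rat.smul_def] at h1 h2
  have h1' : ((s + t : ℚ) : ℝ) * α.re = 0 := by push_cast; linear_combination h1
  have h2' : ((s - t : ℚ) : ℝ) * α.im = 0 := by push_cast; linear_combination h2
  have e1 : s + t = 0 := by exact_mod_cast (mul_eq_zero.1 h1').resolve_right hre
  have e2 : s - t = 0 := by exact_mod_cast (mul_eq_zero.1 h2').resolve_right him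
  constructor <;> linarith

/-- Lindemann–Weierstrass for the pair `(α, ᾱ)`: for `α` algebraic off both axes, `e^α` and
`e^{ᾱ}` are algebraically independent over `ℚ` (tree theorem `algebraicIndependent_exp_holds`).
[cite: BakerTNT1975, Ch. 1 Thm 1.4] -/
theorem algebraicIndependent_exp_exp_conj {α : ℂ} (hα : IsAlgebraic ℚ α) (hre : α.re ≠ 0)
    (him : α.im ≠ 0) :
    AlgebraicIndependent ℚ ![Complex.exp α, Complex.exp ((starRingEnd ℂ) α)] := by
  have halg : ∀ i, IsAlgebraic ℚ (![α, (starRingEnd ℂ) α] i) := by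
    intro i
    fin_cases i
    · exact hα
    · simpa using hα.algHom conjQ
  have h := algebraicIndependent_exp_holds (![α, (starRingEnd ℂ) α]) halg
    (linearIndependent_self_conj hre him)
  convert h using 1
  ext i
  fin_cases i <;> rfl

/-! ## Elements of `L₀ = stage 0` are algebraic over `ℚ(π)` -/

/-- Elements of `L₀ = stage 0 = ℚ(2πi)^{ralg}` are algebraic over `ℚ(π)` (they are algebraic
over `ℚ(2πi) ≤ ℚ(π)^{ralg}`, which is relatively algebraically closed). [folklore] -/
theorem isAlgebraic_adjoin_pi_of_mem_stage_zero {w : ℂ} (hw : w ∈ stage 0) :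
    IsAlgebraic (adjoin ℚ ({(Real.pi : ℂ)} : Set ℂ)) w := by
  have h1 : IsAlgebraic (adjoin ℚ ({(2 * ↑Real.pi * Complex.I : ℂ)} : Set ℂ)) w :=
    mem_relAlg_iff.1 hw
  have hle : adjoin ℚ ({(2 * ↑Real.pi * Complex.I : ℂ)} : Set ℂ) ≤ Kpi :=
    adjoin_le_iff.mpr (Set.singleton_subset_iff.mpr two_pi_I_mem_Kpi)
  exact mem_relAlg_iff.1 (relAlg_closed (adjoin ℚ ({(Real.pi : ℂ)} : Set ℂ)) w
    (isAlgebraic_of_le hle h1))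

end RelLWZeroOffAxes

open RelLWZeroOffAxes

/-! ## `e^α` is transcendental over `ℚ(π)`; `π ⊥ e^α` -/

/-- **Main lemma.** For `α` algebraic with `Re α ≠ 0` and `Im α ≠ 0`, `e^α` is transcendental
over `ℚ(π)`: otherwise `e^{ᾱ} = conj (e^α)` is algebraic over `ℚ(π)` too and
`trdeg_ℚ ℚ(π, e^α, e^{ᾱ}) = trdeg_ℚ ℚ(π) ≤ 1`, against `trdeg ≥ 2` from Lindemann–Weierstrass.
[cite: BakerTNT1975, Ch. 1 Thm 1.4] -/
theorem KernelTower.exp_transcendental_adjoin_pi_offAxes (α : ℂ) (hα : IsAlgebraic ℚ α)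
    (hre : α.re ≠ 0) (him : α.im ≠ 0) :
    Transcendental (adjoin ℚ ({(Real.pi : ℂ)} : Set ℂ)) (Complex.exp α) := by
  intro h
  have h' : IsAlgebraic (adjoin ℚ ({(Real.pi : ℂ)} : Set ℂ))
      (Complex.exp ((starRingEnd ℂ) α)) := by
    rw [Complex.exp_conj]
    exact isAlgebraic_adjoin_pi_conj h
  set T : Set ℂ := {Complex.exp α, Complex.exp ((starRingEnd ℂ) α)} with hT
  have hTalg : ∀ x ∈ T, IsAlgebraic (adjoin ℚ ({(Real.pi : ℂ)} : Set ℂ)) x := by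
    rintro x (rfl | rfl)
    exacts [h, h']
  have hup : Algebra.trdeg ℚ (adjoin ℚ (({(Real.pi : ℂ)} : Set ℂ) ∪ T)) ≤ 1 :=
    (trdeg_adjoin_union_eq_of_isAlgebraic_adjoin _ T hTalg).trans_le
      (trdeg_adjoin_singleton_le_one _)
  have hlow : ((2 : ℕ) : Cardinal) ≤ Algebra.trdeg ℚ (adjoin ℚ (({(Real.pi : ℂ)} : Set ℂ) ∪ T)) :=
    natCast_le_trdeg_of_algebraicIndependent_mem _ (algebraicIndependent_exp_exp_conj hα hre him)
      (fun i => subset_adjoin ℚ _ (Or.inr (by fin_cases i <;> simp [hT])))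
  have := hlow.trans hup
  norm_num at this

/-- **`π ⊥ e^α`** for `α` algebraic off both axes (e.g. `π ⊥ e^{1+i}`): `π` is transcendental
(Lindemann, tree theorem `transcendental_pi_holds`) and `e^α` is transcendental over `ℚ(π)`.
[cite: BakerTNT1975, Ch. 1 Thm 1.4] -/
theorem KernelTower.algebraicIndependent_pi_exp_offAxes (α : ℂ) (hα : IsAlgebraic ℚ α)
    (hre : α.re ≠ 0) (him : α.im ≠ 0) :
    AlgebraicIndependent ℚ ![(Real.pi : ℂ), Complex.exp α] := by
  have hπ : Transcendental ℚ (Real.pi : ℂ) := fun h =>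
    transcendental_pi_holds ((isAlgebraic_algebraMap_iff (A := ℂ) Complex.ofReal_injective).mp h)
  have h1 : AlgebraicIndependent ℚ ![(Real.pi : ℂ)] :=
    algebraicIndependent_iff_transcendental.2 hπ
  have h2 : Transcendental (Algebra.adjoin ℚ (Set.range ![(Real.pi : ℂ)])) (Complex.exp α) := by
    rw [Matrix.range_cons_empty, ← IntermediateField.transcendental_adjoin_iff]
    exact KernelTower.exp_transcendental_adjoin_pi_offAxes α hα hre him
  have h := (AlgebraicIndependent.option_iff (x := ![(Real.pi : ℂ)]) (a := Complex.exp α)).2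
    ⟨h1, h2⟩
  have e : (![(Real.pi : ℂ), Complex.exp α]) =
      (fun o : Option (Fin 1) => o.elim (Complex.exp α) ![(Real.pi : ℂ)]) ∘ ![some 0, none] := by
    ext i
    fin_cases i <;> rfl
  rw [e]
  exact h.comp _ (fun i j hij => by fin_cases i <;> fin_cases j <;> simp_all)

/-! ## From `ℚ(π)` to `L₀ = stage 0 = ℚ(π)^{ralg}` -/

/-- **`e^α ∉ L₀`**: for `α` algebraic off both axes, `e^α ∉ stage 0 = ℚ(2πi)^{ralg}` (elements
of `stage 0` are algebraic over `ℚ(π)`). [cite: BakerTNT1975, Ch. 1 Thm 1.4] -/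
theorem KernelTower.exp_not_mem_stage_zero_offAxes (α : ℂ) (hα : IsAlgebraic ℚ α)
    (hre : α.re ≠ 0) (him : α.im ≠ 0) : Complex.exp α ∉ stage 0 := fun h =>
  KernelTower.exp_transcendental_adjoin_pi_offAxes α hα hre him
    (isAlgebraic_adjoin_pi_of_mem_stage_zero h)

/-- `e^α` is transcendental over `L₀ = stage 0` for `α` algebraic off both axes (`L₀` is
relatively algebraically closed and misses `e^α`). [cite: BakerTNT1975, Ch. 1 Thm 1.4] -/
theorem KernelTower.exp_transcendental_stage_zero_offAxes (α : ℂ) (hα : IsAlgebraic ℚ α)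
    (hre : α.re ≠ 0) (him : α.im ≠ 0) : Transcendental (stage 0) (Complex.exp α) := fun h =>
  KernelTower.exp_not_mem_stage_zero_offAxes α hα hre him (stage_closed 0 _ h)

/-! ## The tuple version: `(u, ū)` `ℚ`-linearly independent -/

/-- **Tuple version of `RelLW₀` on the conjugation-free algebraic sector.**  For algebraic
`u : Fin r → ℂ` such that the `2r` numbers `(u, ū)` are `ℚ`-linearly independent, the `e^{u i}`
are algebraically independent over `L₀ = stage 0`.  By Lindemann–Weierstrass the `2r` numbers
`(e^u, e^{ū})` are algebraically independent over `ℚ`; if `π` were algebraic over `ℚ(e^u)` then,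
conjugating, also over `ℚ(e^{ū})`, so `π` would lie in the intersection of the two flats
`acl ℚ(e^u) ∩ acl ℚ(e^{ū}) = acl ℚ(∅)` of the algebraic matroid
(`Matroid.Indep.closure_inter_eq_inter_closure`), contradicting Lindemann; hence `(π, e^u)` is
algebraically independent, i.e. `e^u` is independent over `ℚ(π)`, hence over `ℚ(π)^{ralg} ≥ L₀`.
[cite: BakerTNT1975, Ch. 1 Thm 1.4] -/
theorem KernelTower.algebraicIndependent_stage_zero_exp_of_conjFree {r : ℕ} (u : Fin r → ℂ)
    (hu : ∀ i, IsAlgebraic ℚ (u i))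
    (hli : LinearIndependent ℚ (Sum.elim u (fun i => (starRingEnd ℂ) (u i)))) :
    AlgebraicIndependent (stage 0) (fun i => Complex.exp (u i)) := by
  set x : Fin r → ℂ := fun i => Complex.exp (u i) with hx
  set y : Fin r → ℂ := fun i => Complex.exp ((starRingEnd ℂ) (u i)) with hy
  have hπ : Transcendental ℚ (Real.pi : ℂ) := fun h =>
    transcendental_pi_holds ((isAlgebraic_algebraMap_iff (A := ℂ) Complex.ofReal_injective).mp h)
  -- (1) Lindemann–Weierstrass on the `2r`-tuple `(u, ū)`
  have hxy : AlgebraicIndependent ℚ (Sum.elim x y) := by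
    have halg : ∀ s, IsAlgebraic ℚ (Sum.elim u (fun i => (starRingEnd ℂ) (u i)) s) := by
      rintro (i | i)
      · exact hu i
      · simpa using (hu i).algHom conjQ
    convert algebraicIndependent_exp_holds _ halg hli using 1
    ext (i | i) <;> rfl
  have hxi : AlgebraicIndependent ℚ x := by
    have h := hxy.comp _ Sum.inl_injective
    rwa [Sum.elim_comp_inl] at h
  have hyi : AlgebraicIndependent ℚ y := by
    have h := hxy.comp _ Sum.inr_injective
    rwa [Sum.elim_comp_inr] at h
  -- `(π, v)` is independent iff `π` is transcendental over `ℚ(v)`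
  have claim : ∀ v : Fin r → ℂ, AlgebraicIndependent ℚ v →
      (AlgebraicIndependent ℚ (Sum.elim ![(Real.pi : ℂ)] v) ↔
        Transcendental (Algebra.adjoin ℚ (Set.range v)) (Real.pi : ℂ)) := fun v hv =>
    AlgebraicIndependent.sumElim_iff.trans
      ⟨fun h => algebraicIndependent_iff_transcendental.1 h.2,
        fun h => ⟨hv, algebraicIndependent_iff_transcendental.2 h⟩⟩
  -- (2) conjugation maps `(π, e^{ū})` to `(π, e^u)`
  have hconj : AlgebraicIndependent ℚ (Sum.elim ![(Real.pi : ℂ)] y) →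
      AlgebraicIndependent ℚ (Sum.elim ![(Real.pi : ℂ)] x) := fun h => by
    have h' := h.map' (f := conjQ) conjQ.toRingHom.injective
    have e : ⇑conjQ ∘ Sum.elim ![(Real.pi : ℂ)] y = Sum.elim ![(Real.pi : ℂ)] x := by
      funext s
      rcases s with i | i
      · fin_cases i
        simp [Complex.conj_ofReal]
      · simp [hx, hy, ← Complex.exp_conj]
    rwa [e] at h'
  -- (3) `(π, e^u)` is algebraically independent: flat intersection in the algebraic matroid
  have hPx : AlgebraicIndependent ℚ (Sum.elim ![(Real.pi : ℂ)] x) := by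
    by_contra hnx
    have hny : ¬ AlgebraicIndependent ℚ (Sum.elim ![(Real.pi : ℂ)] y) := fun h => hnx (hconj h)
    rw [claim x hxi] at hnx
    rw [claim y hyi] at hny
    simp only [Transcendental, not_not] at hnx hny
    set M := AlgebraicIndependent.matroid ℚ ℂ with hM
    have hI : M.Indep (Set.range x ∪ Set.range y) := by
      rw [← Set.Sum.elim_range]
      exact AlgebraicIndependent.matroid_indep_iff.2 hxy.coe_range
    have hdisj : Set.range x ∩ Set.range y = ∅ := by
      have hinj := Sum.elim_injective.1 hxy.injective
      refine Set.eq_empty_iff_forall_notMem.2 ?_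
      rintro _ ⟨⟨a, rfl⟩, ⟨b, hb⟩⟩
      exact hinj.2.2 a b hb.symm
    have hmx : (Real.pi : ℂ) ∈ M.closure (Set.range x) := by
      rw [hM, AlgebraicIndependent.matroid_closure_eq]
      exact hnx
    have hmy : (Real.pi : ℂ) ∈ M.closure (Set.range y) := by
      rw [hM, AlgebraicIndependent.matroid_closure_eq]
      exact hny
    have hloop : M.IsLoop (Real.pi : ℂ) := by
      show (Real.pi : ℂ) ∈ M.closure ∅
      rw [← hdisj, hI.closure_inter_eq_inter_closure]
      exact ⟨hmx, hmy⟩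
    have hind : M.Indep {(Real.pi : ℂ)} :=
      AlgebraicIndependent.matroid_indep_iff.2
        (algebraicIndependent_unique_type_iff.2 (by simpa using hπ))
    exact hloop.notMem_of_indep hind (Set.mem_singleton _)
  -- (4) so `e^u` is independent over `ℚ(π)`, over `ℚ(π)^{ralg}`, and over `L₀ ≤ ℚ(π)^{ralg}`
  have hxπ : AlgebraicIndependent ℚ (Sum.elim x ![(Real.pi : ℂ)]) := by
    rw [← Sum.elim_swap]
    exact hPx.comp _ Sum.swap_leftInverse.injective
  have hF : AlgebraicIndependent (adjoin ℚ ({(Real.pi : ℂ)} : Set ℂ)) x := by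
    have h2 := (AlgebraicIndependent.sumElim_iff.1 hxπ).2
    rw [Matrix.range_cons_empty] at h2
    exact IntermediateField.algebraicIndependent_adjoin_iff.2 h2
  have hK : AlgebraicIndependent (↥Kpi) x := hF.algebraicClosure
  have hle : stage 0 ≤ Kpi := fun _ hw =>
    mem_relAlg_iff.2 (isAlgebraic_adjoin_pi_of_mem_stage_zero hw)
  exact Literature.NumberTheory.Transcendental.AlgebraicIndependent.of_intermediateField_le hle hK

/-- **Stub `stub_relLWZero_offAxes` of line `kernel-tower-relative-lw`** (`RelLW₀` on the
off-axes algebraic line, registered signature): for `α` algebraic with `Re α ≠ 0` and `Im α ≠ 0`,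
the one-element family `(e^α)` is algebraically independent over `L₀ = stage 0 = ℚ(2πi)^{ralg}`,
i.e. `e^α` is transcendental over `L₀` — Lindemann–Weierstrass on `(α, ᾱ)` plus complex
conjugation. [cite: BakerTNT1975, Ch. 1 Thm 1.4] -/
theorem stub_relLWZero_offAxes :
    ∀ α : ℂ, IsAlgebraic ℚ α → α.re ≠ 0 → α.im ≠ 0 →
      AlgebraicIndependent (↥(stage 0)) (fun _ : Fin 1 => Complex.exp α) := by
  intro α hα hre him
  rw [algebraicIndependent_unique_type_iff]
  exact KernelTower.exp_transcendental_stage_zero_offAxes α hα hre him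

end Summit.Schanuel.Schanuel.Theorems.RigidCore
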